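import Literature.MathematicalPhysics.QuantumFieldTheory.Balaban1983to89.B9Eq353FormDefectTowerTwoBackgrounds
import Literature.MathematicalPhysics.QuantumFieldTheory.Balaban1983to89.B9Eq3153FrakGLipschitzEnergy

/-!
# `Balaban1983to89.B9Eq3153FrakGkLipschitzEnergyTwoBackgrounds` — T. Bałaban, *Propagators for lattice gauge theories in a background field*, Commun. Math.
# Phys. **99** (1985) 389–434 [Balaban1985BackgroundPropagators] (3.153) p. 426 with Thm 3.13 p. 426, Thm 3.4 p. 400, (3.84)–(3.86) p. 407 AT `k = n+1`
# AVERAGING LEVELS ON PRINT's DIAGONAL, BETWEEN TWO SMALL BACKGROUNDS: **`‖𝔊_k(U)x − 𝔊_k(V)x‖_{N₁} ≤ C·δ·‖x‖` MODULO `C_R^{(2)}`, `C_{K,V}`, `C_{K,U}`** — the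
# two-background («(b3)») twin of the NE9 owner's storey 6 `B9Eq3153FrakGkLipschitzEnergyDiagonal` (there `V = 1`, `δ = α`): the owner's abstract
# `B9Eq3153FrakGLipschitzEnergy.norm_apply_frakG_sub_le` (structures 0 := `V`, 1 := `U`) fed with INTENT-7's two-background form defect, the energy letters
# at `U` and at `V` (coercivity and the `RD*` row), the two-background derivative ∕ divergence ∕ `R` ∕ `Q_k` letters — in the DOUBLED flat weight `2N₁`
# (so that the base's divergence row `‖D*_V w‖ ≤ (1 + s_Sα)N₁(w) ≤ 2N₁(w)` is letter-free, as the abstract lemma wants)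

statement-level skeleton of published theorems with citation tags; proofs where landed; nothing here is a claim about the Yang–Mills mass gap

PDF held: `paper:balaban1985-cmp99-background-propagators` (journal page = PDF page + 388), pp. 400, 407, 426 through the suppliers' quotations.

CITATION HEADER (lean-in-tree rule 2026-08-18).  Audit cell `pub-balaban`, sub-cell `t4`, NE9 crux team (2): LEAF PROVER 04 (`b2b-balaban-t4-ne9-formalise-leaf-04`
gen 77), INTENT-11.  WHY: the third row of the two-background energy ball (`G_k`: INTENT-8, `H_k`: INTENT-10, `𝔊_k`: this) — the input of the k-level
two-background (117) letter defects (the OWNER's offer l.51017).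

THE PRINT.  (3.153) p. 426: `𝔊 = G − HQG − GDRD*G`-type third Green's letter; Thm 3.13 p. 426; (3.86) p. 407: Lipschitz in the background.

WHAT IS PROVED (sorry-free; 0 `def`; [folklore] composition BY NAME; nothing of [B9] asserted as printed).
* **`exists_norm_frakGk_sub_frakGk_le_two_backgrounds_closed`** — `∃ α₀ δ₀ C > 0` (`C` closed in `(d, a, L, M_φ, M_φ′, r, C_τ, ρ_w, C_R^{(2)}, C_{K,V}, C_{K,U})`)
  BEFORE the binders of INTENT-10 (`B9Eq3126H1kLipschitzEnergyTwoBackgrounds`), then for every `x`: `‖𝔊_k(U)x − 𝔊_k(V)x‖, ‖curl₁(…)‖, ‖div₁(…)‖ ≤ C·δ·‖x‖`,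
  `𝔊_k(X) = frakGLatticeK hposX hQX`.
MODEL ∕ DECLARED READINGS.  Those of INTENT-7∕-10 (every window ∕ profile ∕ closeness letter, `C_R^{(2)}`, the `K⁻¹`-letters and the witnesses DISPLAYED);
`α₀ ≤ 1∕(s_S + 1)` added so that `s_Sα ≤ 1`.
HONEST SCOPE.  FIRST order between two small backgrounds on the diagonal ONLY; the `L²`∕energy clause — no kernel bound, no decay, NOT the (N)-reading; crude
constants.  NOT summit progress (cell pub-balaban: NE9 NOT PRINTED ∕ NOT PROVED; «NE9 ⇐ the named binders»; row WALLED ON A MODEL (O-NE9-1; #5 UNRULED); spine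
PROVED 0∕9; rung (B)+1 finite T⁴ — NOT infinite volume, NOT mass gap, NOT BetaPertH, NOT Clay).  HONEST DEPENDENCY (cell line): continuum YM on T⁴ ⇐ BetaPertH ∧
nine spine estimates (0/9 proved); BetaPertH ⇐ (D1) ∧ (D4) ∧ CAP+tail; G-an2-4 gates asym, D1 and NE2/3/4.  NEW file; nothing modified.  Net new unproved facts: 0.
-/

noncomputable section

open scoped InnerProductSpace ComplexConjugate BigOperators

namespace Literature.MathematicalPhysics.QuantumFieldTheory.Balaban1983to89.B9Eq3153FrakGkLipschitzEnergyTwoBackgrounds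

open B4Sect5Torus (TSite)
open B9SectCLatticeCarrier (Bond)
open B11Eq103H1Complex (SiteL2K BondL2K covDerivL2K covDivL2K laplaceALatticeK laplaceAK frakGLatticeK KinvLatticeK KinvK adjoint_injective_of_surjective
  adjoint_covDerivL2K projR_projR)
open B9Eq310HessianOperator (adTransportW hessOp covCurlL2K)
open B9Eq310DeltaPrime (plaqHolU)
open B9Eq315QTorus (perCfg cornerSite)
open B9Eq315QTower (towerP UlevOf)
open B9Eq315QTowerFlat (perCfg_UlevOf_one_mem_U1 norm_Wcx_UlevOf_one_sub_one_le)
open B9Eq326OperatorTower (laplaceAk QkW RofUk RofUk_isSymmetric)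
open B7Prop1Explicit (U1 Wcx boxVec)
open B9Eq373DerivativeRemainderL2 (norm_covDivL2K_sub_le)
open B9Eq373DerivativeRemainderTwoBackgrounds (norm_covDerivL2K_sub_le₂ norm_covDivL2K_sub_le₂)
open B9Eq368ProjectionRemainder (norm_projR_le)
open B9Eq384RemainderLetters (norm_adTransportW_sub_le)
open B9Eq368RLipschitzTwoBackgrounds (norm_adTransportW_sub_adTransportW_le)
open B9Eq315QTowerLipschitzL2 (norm_QkW_sub_flat_le_L2_geometric)
open B9Eq315QTowerLipschitzL2TwoBackgroundsChain (norm_QkW_sub_QkW_le_L2_linear)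
open B9Eq315QTowerFlatNorm (norm_QkW_one_le_canonical)
open B5Eq172HodgePositivity (adTransportW_one adTransportW_inv_one)
open B9Eq3153FrakGkBoundDiagonal (exists_energy_letters_diagonal_closed)
open B9Eq353FormDefectTowerTwoBackgrounds (exists_form_defect_two_backgrounds_diagonal_closed)
open B9Eq3153FrakGLipschitzEnergy (norm_apply_frakG_sub_le)

/-! ## §1 Arithmetic -/

/-- `e^y − 1 ≤ 2y` for `0 ≤ y ≤ 1`. [folklore] -/
private theorem exp_sub_one_le_two_mul {y : ℝ} (hy0 : 0 ≤ y) (hy1 : y ≤ 1) : Real.exp y - 1 ≤ 2 * y := by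
  have h := Real.abs_exp_sub_one_le (x := y) (by rw [abs_of_nonneg hy0]; exact hy1)
  rw [abs_of_nonneg hy0] at h
  exact (le_abs_self _).trans h

/-- On the diagonal `c₀(L^{n+1})^d = c₁` the weighted-reading prefactor is `1`. [cite: Balaban1985BackgroundPropagators, (3.16) p.393] -/
private theorem sqrt_ratio_diagonal {d L n : ℕ} {c₀ c₁ : ℝ} (hc₁ : 0 < c₁) (hw : c₀ * ((L : ℝ) ^ (n + 1)) ^ d = c₁) :
    Real.sqrt (c₁ / (c₀ * ((L : ℝ) ^ (n + 1)) ^ d)) = 1 := by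
  rw [hw, div_self hc₁.ne', Real.sqrt_one]

/-- `x ≤ √S` from `0 ≤ x` and `x² ≤ S`. [folklore] -/
private theorem le_sqrt_of_sq_le {x S : ℝ} (hx : 0 ≤ x) (h : x ^ 2 ≤ S) : x ≤ Real.sqrt S := by
  rw [← Real.sqrt_sq hx]; exact Real.sqrt_le_sqrt h

/-! ## §2 `𝔊_k(U) − 𝔊_k(V)` in the flat energy norm on the diagonal -/

variable {d : ℕ} (L : ℕ) [NeZero L] (hL : 1 ≤ L)
  {𝔸 : Type*} [NormedRing 𝔸] [NormedAlgebra ℂ 𝔸] [CompleteSpace 𝔸] [NormOneClass 𝔸] [StarRing 𝔸] [NormedStarGroup 𝔸] [StarModule ℂ 𝔸]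
  {W : Type*} [NormedAddCommGroup W] [InnerProductSpace ℂ W] [FiniteDimensional ℂ W] (φ : W ≃ₗ[ℂ] 𝔸)
  {Mφ Mφ' : ℝ} (hMφ : 0 ≤ Mφ) (hMφ' : 0 ≤ Mφ') (hφ : ∀ w, ‖φ w‖ ≤ Mφ * ‖w‖) (hφ' : ∀ X, ‖φ.symm X‖ ≤ Mφ' * ‖X‖)
  {a : ℝ} (ha : 0 < a) {r : ℝ} (hr0 : 0 ≤ r) (hr1 : r < 1)
  (τ : 𝔸 →ₗ[ℂ] ℂ) {Cτ : ℝ} (hτ : ∀ X, ‖τ X‖ ≤ Cτ * ‖X‖) (hCτ : 0 ≤ Cτ) {ρw : ℝ} (hρw : 0 ≤ ρw) {CR : ℝ} (hCR : 0 ≤ CR)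
  {CKV CKU : ℝ} (hCKV : 0 ≤ CKV) (hCKU : 0 ≤ CKU)

include hMφ hMφ' hφ hφ' ha hr0 hr1 hτ hCτ hρw hCR hCKV hCKU

-- deep definitional unfolding `frakGLatticeK`∕`KinvLatticeK` ↦ `frakGLin (G1K …)`∕`KinvK` (as in the owner's storey 6); the 40-letter composition exceeds the
-- default heartbeat budget of ONE declaration (disclosed)
set_option maxHeartbeats 800000 in
set_option maxRecDepth 8192 in
/-- **`𝔊_k(U) − 𝔊_k(V) = O(δ)` IN THE FLAT ENERGY NORM ON THE DIAGONAL, MODULO `C_R^{(2)}`, `C_{K,V}`, `C_{K,U}`**: `∃ α₀ δ₀ C > 0` (closed) such that under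
the binders of INTENT-10 and every `x`: `‖𝔊_k(U)x − 𝔊_k(V)x‖, ‖curl₁(…)‖, ‖div₁(…)‖ ≤ C·δ·‖x‖` — the owner's storey-6 text with (0 := V, 1 := U) in the doubled
flat weight `2N₁`: `norm_apply_frakG_sub_le` at the coercivities `γ₁∕4` (of `2N₁`), the two-background form defect `Θ̄₂δ`, `δ_Q = s_Qδ`, `M_Q = M_φ′M_φ + C_Q`,
`δ_P = (s_S + 2C_R)δ`, `M_P = 1`, `c_R = 2` twice, `δ_D = s_Sδ`, `δ_R = C_Rδ`, `M_R = 1`.  No operator bound of `Δ_a`, no Neumann series.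
[cite: Balaban1985BackgroundPropagators, (3.153) p.426, Thm 3.13 p.426, Thm 3.4 p.400, (3.84)–(3.86) p.407, (3.35) p.396; Balaban1985Variational, (45) p.285] -/
theorem exists_norm_frakGk_sub_frakGk_le_two_backgrounds_closed :
    ∃ α₀ δ₀ C : ℝ, 0 < α₀ ∧ 0 < δ₀ ∧ 0 < C ∧ ∀ (n : ℕ) (η : ℝ), η * (L : ℝ) ^ (n + 1) = 1 →
      ∀ (c₀ c₁ : ℝ) [Fact (0 < c₀)] [Fact (0 < c₁)], c₀ * ((L : ℝ) ^ (n + 1)) ^ d = c₁ → |η| ^ d / c₀ ≤ ρw →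
      ∀ (m : Fin d → ℕ) [∀ i, NeZero (m i)] (U V : Bond d (towerP L m (n + 1)) → 𝔸ˣ) (αU : ℕ → ℝ) (hα1 : ∀ j, αU j ≤ 1 / 64)
        (hU1 : ∀ (j : ℕ) (x : B7Prop1Explicit.Site d) (κ : Fin d), perCfg (towerP L m (j + 1)) (UlevOf L m (n + 1) U j) x κ ∈ U1 𝔸)
        (hreg : ∀ (j : ℕ) (y : TSite d (towerP L m j)) (κ : Fin d) (r : Fin d → Fin L),
          ‖((Wcx L (perCfg (towerP L m (j + 1)) (UlevOf L m (n + 1) U j)) (cornerSite L y) κ (boxVec L r) : 𝔸ˣ) : 𝔸) - 1‖ ≤ αU j)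
        (αV : ℕ → ℝ) (hα1' : ∀ j, αV j ≤ 1 / 64)
        (hV1 : ∀ (j : ℕ) (x : B7Prop1Explicit.Site d) (κ : Fin d), perCfg (towerP L m (j + 1)) (UlevOf L m (n + 1) V j) x κ ∈ U1 𝔸)
        (hregV : ∀ (j : ℕ) (y : TSite d (towerP L m j)) (κ : Fin d) (r : Fin d → Fin L),
          ‖((Wcx L (perCfg (towerP L m (j + 1)) (UlevOf L m (n + 1) V j)) (cornerSite L y) κ (boxVec L r) : 𝔸ˣ) : 𝔸) - 1‖ ≤ αV j),
        (∀ j, αV j ≤ 1 / 128) →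
      ∀ (εU : ℕ → ℝ), (∀ j, 0 ≤ εU j) → (∀ (j : ℕ) (b : Bond d (towerP L m (j + 1))), ‖(UlevOf L m (n + 1) U j b : 𝔸) - 1‖ ≤ εU j) →
        (∀ (j : ℕ) (b : Bond d (towerP L m (j + 1))), ‖(UlevOf L m (n + 1) V j b : 𝔸) - 1‖ ≤ εU j) →
      ∀ (δUV : ℕ → ℝ), (∀ j, 0 ≤ δUV j) →
        (∀ (j : ℕ) (b : Bond d (towerP L m (j + 1))), ‖(UlevOf L m (n + 1) U j b : 𝔸) - (UlevOf L m (n + 1) V j b : 𝔸)‖ ≤ δUV j) →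
      ∀ {α δ : ℝ}, 0 ≤ α → α ≤ α₀ → 0 ≤ δ → δ ≤ δ₀ →
        (∀ (b : Bond d (towerP L m (n + 1))) (v u : W), ⟪adTransportW φ U b v, u⟫_ℂ = ⟪v, adTransportW φ (fun b => (U b)⁻¹) b u⟫_ℂ) →
        (∀ (b : Bond d (towerP L m (n + 1))) (v u : W), ⟪adTransportW φ V b v, u⟫_ℂ = ⟪v, adTransportW φ (fun b => (V b)⁻¹) b u⟫_ℂ) →
        (∀ b, U b ∈ U1 𝔸) → (∀ b, V b ∈ U1 𝔸) → (∀ b, ‖(U b : 𝔸) - 1‖ ≤ α * η) → (∀ b, ‖(V b : 𝔸) - 1‖ ≤ α * η) →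
        (∀ p : B9SectCLatticeCarrier.Plaq d (towerP L m (n + 1)), ‖(plaqHolU U p : 𝔸) - 1‖ ≤ α * η ^ 2) →
        (∀ p : B9SectCLatticeCarrier.Plaq d (towerP L m (n + 1)), ‖(plaqHolU V p : 𝔸) - 1‖ ≤ α * η ^ 2) →
        (∀ b, ‖(U b : 𝔸) - (V b : 𝔸)‖ ≤ δ * η) →
        (∀ p : B9SectCLatticeCarrier.Plaq d (towerP L m (n + 1)), ‖(plaqHolU U p : 𝔸) - (plaqHolU V p : 𝔸)‖ ≤ δ * η ^ 2) →
        (∀ j < n + 1, εU j ≤ α * r ^ j) → (∀ j, δUV j ≤ δ * r ^ j) →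
        (∀ s : SiteL2K ℂ d (towerP L m (n + 1)) c₀ W, ‖RofUk L m n φ η U s - RofUk L m n φ η V s‖ ≤ CR * δ * ‖s‖) →
        ∀ (hposU : ∀ x : BondL2K ℂ d (towerP L m (n + 1)) c₀ W, x ≠ 0 →
            0 < RCLike.re ⟪x, laplaceAk L m n φ η U hL αU hα1 hU1 hreg τ (c₀ := c₀) (c₁ := c₁) a x⟫_ℂ)
          (hposV : ∀ x : BondL2K ℂ d (towerP L m (n + 1)) c₀ W, x ≠ 0 →
            0 < RCLike.re ⟪x, laplaceAk L m n φ η V hL αV hα1' hV1 hregV τ (c₀ := c₀) (c₁ := c₁) a x⟫_ℂ)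
          (hQU : Function.Surjective (QkW L m n φ U hL αU hα1 hU1 hreg (c₀ := c₀) (c₁ := c₁)))
          (hQV : Function.Surjective (QkW L m n φ V hL αV hα1' hV1 hregV (c₀ := c₀) (c₁ := c₁))),
        (∀ b : BondL2K ℂ d m c₁ W, ‖KinvLatticeK hposV hQV b‖ ≤ CKV * ‖b‖) →
        (∀ c : BondL2K ℂ d m c₁ W, ‖KinvLatticeK hposU hQU c‖ ≤ CKU * ‖c‖) →
        ∀ x : BondL2K ℂ d (towerP L m (n + 1)) c₀ W,
          ‖frakGLatticeK hposU hQU x - frakGLatticeK hposV hQV x‖ ≤ C * δ * ‖x‖ ∧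
          ‖covCurlL2K ℂ c₀ ((η : ℂ))⁻¹ (adTransportW φ (fun _ : Bond d (towerP L m (n + 1)) => (1 : 𝔸ˣ))) (frakGLatticeK hposU hQU x - frakGLatticeK hposV hQV x)‖ ≤
            C * δ * ‖x‖ ∧
          ‖covDivL2K ℂ c₀ ((η : ℂ))⁻¹ (adTransportW φ fun _ : Bond d (towerP L m (n + 1)) => (1 : 𝔸ˣ)⁻¹) (frakGLatticeK hposU hQU x - frakGLatticeK hposV hQV x)‖ ≤
            C * δ * ‖x‖ := by
  obtain ⟨α₁, γ₁, hα₁, hγ₁, H1⟩ := exists_energy_letters_diagonal_closed L hL φ hMφ hMφ' hφ hφ' ha hr0 hr1 τ hτ hCτ hρw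
  obtain ⟨α₂, δ₂, Θ, hα₂, hδ₂, hΘ, H2⟩ :=
    exists_form_defect_two_backgrounds_diagonal_closed L hL φ hMφ hMφ' hφ hφ' ha hr0 hr1 τ hτ hCτ hρw hCR
  have h1r : 0 < 1 - r := by linarith
  have hγ4 : 0 < γ₁ / 4 := by positivity
  obtain ⟨sS, hsSdef⟩ : ∃ sS : ℝ, sS = 2 * Real.sqrt d * (Mφ * Mφ') := ⟨_, rfl⟩
  obtain ⟨Ξ, hΞdef⟩ : ∃ Ξ : ℝ, Ξ = Real.sqrt ((L : ℝ) ^ d) * (Real.sqrt (2 * d) * (102 * (d + 1) ^ 2 * L)) := ⟨_, rfl⟩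
  obtain ⟨CQ, hCQdef⟩ : ∃ CQ : ℝ, CQ = 2 * (Mφ' * Mφ) * Ξ / (1 - r) := ⟨_, rfl⟩
  obtain ⟨BQ, hBQdef⟩ : ∃ BQ : ℝ, BQ = Real.sqrt ((L : ℝ) ^ d) * (Real.sqrt (2 * d) * (75497472 * ((d : ℝ) + 1) * ((2 * (d * L) + L + L : ℕ) : ℝ))) / (1 - r) := ⟨_, rfl⟩
  obtain ⟨sQ, hsQdef⟩ : ∃ sQ : ℝ, sQ = Mφ' * Mφ * (2 * Real.exp 1 * BQ) := ⟨_, rfl⟩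
  obtain ⟨MQ0, hMQ0def⟩ : ∃ MQ0 : ℝ, MQ0 = Mφ' * Mφ + CQ := ⟨_, rfl⟩
  obtain ⟨sP, hsPdef⟩ : ∃ sP : ℝ, sP = sS + 2 * CR := ⟨_, rfl⟩
  have hsS : 0 ≤ sS := by rw [hsSdef]; positivity
  have hΞ0 : 0 ≤ Ξ := by rw [hΞdef]; positivity
  have hCQ : 0 ≤ CQ := by rw [hCQdef]; positivity
  have hBQ : 0 ≤ BQ := by rw [hBQdef]; positivity
  have hsQ : 0 ≤ sQ := by rw [hsQdef]; positivity
  have hMM : 0 ≤ Mφ' * Mφ := mul_nonneg hMφ' hMφ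
  have hMQ0 : 0 ≤ MQ0 := by rw [hMQ0def]; positivity
  have hsP : 0 ≤ sP := by rw [hsPdef]; positivity
  have hNN : (0 : ℝ) < 12288 * ((2 * (d * L) + L + L : ℕ) : ℝ) := by
    have : (1 : ℝ) ≤ ((2 * (d * L) + L + L : ℕ) : ℝ) := by exact_mod_cast (show 1 ≤ 2 * (d * L) + L + L by nlinarith [hL])
    positivity
  obtain ⟨Cb, hCbdef⟩ : ∃ Cb : ℝ, Cb = Θ / (γ₁ / 4) * (γ₁ / 4)⁻¹ +
      ((((Θ * Real.sqrt (CKV / (γ₁ / 4)) + sQ * CKV) / (γ₁ / 4) + Real.sqrt (CKU / (γ₁ / 4)) * (sQ * Real.sqrt (CKV / (γ₁ / 4)))) * MQ0 * (γ₁ / 4)⁻¹ +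
        Real.sqrt (CKV / (γ₁ / 4)) * (sQ * (γ₁ / 4)⁻¹ + MQ0 * (Θ / (γ₁ / 4)) * (γ₁ / 4)⁻¹)) +
      (Real.sqrt ((γ₁ / 4)⁻¹ * 2) * (sP * (γ₁ / 4)⁻¹ + 1 * (Θ / (γ₁ / 4)) * (γ₁ / 4)⁻¹) +
        ((γ₁ / 4)⁻¹ * sS * 1 + Real.sqrt ((γ₁ / 4)⁻¹ * (γ₁ / 4)⁻¹) * CR + Θ / (γ₁ / 4) * Real.sqrt (2 / (γ₁ / 4))) * 1 * (γ₁ / 4)⁻¹)) := ⟨_, rfl⟩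
  have hCb : 0 ≤ Cb := by rw [hCbdef]; positivity
  refine ⟨min (min α₁ α₂) (min (1 / (sS + 1)) ((1 - r) / (Ξ + 1))), min δ₂ (min (1 / (12288 * ((2 * (d * L) + L + L : ℕ) : ℝ))) (1 / (BQ + 1))), Cb + 1,
    lt_min (lt_min hα₁ hα₂) (lt_min (by positivity) (by positivity)), lt_min hδ₂ (lt_min (by positivity) (by positivity)), by positivity, ?_⟩
  intro n η hηL c₀ c₁ _ _ hw hρ m _ U V αU hα1 hU1 hreg αV hα1' hV1 hregV hα128 εU hεU hUε hVε δUV hδUV hLUV α δ hα0 hαle hδ0 hδle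
    hRSU hRSV hUb hVb hUη hVη hplU hplV hUV hpp hεg hδg hR2 hposU hposV hQU hQV hKV hKU x
  have hc₁ : 0 < c₁ := Fact.out
  have hL1 : (1 : ℝ) ≤ L := by exact_mod_cast hL
  have hLr : (1 : ℝ) ≤ (L : ℝ) ^ (n + 1) := one_le_pow₀ hL1
  have hηL0 : 0 < η * (L : ℝ) ^ (n + 1) := by rw [hηL]; exact one_pos
  have hη0 : 0 < η := pos_of_mul_pos_left hηL0 (by positivity)
  have hc : conj ((η : ℂ))⁻¹ = ((η : ℂ))⁻¹ := by rw [map_inv₀, Complex.conj_ofReal]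
  have hnη : ‖((η : ℂ))⁻¹‖ * η = 1 := by
    rw [norm_inv, Complex.norm_real, Real.norm_eq_abs, abs_of_pos hη0, inv_mul_cancel₀ hη0.ne']
  have hs : c₁ * (η * (L : ℝ) ^ (n + 1)) ^ 2 = c₀ * ((L : ℝ) ^ (n + 1)) ^ d := by rw [hηL, one_pow, mul_one, hw]
  have hαα₁ : α ≤ α₁ := hαle.trans ((min_le_left _ _).trans (min_le_left _ _))
  have hαα₂ : α ≤ α₂ := hαle.trans ((min_le_left _ _).trans (min_le_right _ _))
  have hδδ₂ : δ ≤ δ₂ := hδle.trans (min_le_left _ _)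
  have hδN : δ ≤ 1 / (12288 * ((2 * (d * L) + L + L : ℕ) : ℝ)) := hδle.trans ((min_le_right _ _).trans (min_le_left _ _))
  have hδB : BQ * δ ≤ 1 := by
    have h1 : δ ≤ 1 / (BQ + 1) := hδle.trans ((min_le_right _ _).trans (min_le_right _ _))
    calc BQ * δ ≤ BQ * (1 / (BQ + 1)) := mul_le_mul_of_nonneg_left h1 hBQ
      _ ≤ 1 := by rw [mul_one_div, div_le_one (by positivity)]; linarith
  have hsSα1 : sS * α ≤ 1 := by
    have h1 : α ≤ 1 / (sS + 1) := hαle.trans ((min_le_right _ _).trans (min_le_left _ _))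
    calc sS * α ≤ sS * (1 / (sS + 1)) := mul_le_mul_of_nonneg_left h1 hsS
      _ ≤ 1 := by rw [mul_one_div, div_le_one (by positivity)]; linarith
  have hαone : α ≤ 1 := by
    have h1 : α ≤ 1 / (sS + 1) := hαle.trans ((min_le_right _ _).trans (min_le_left _ _))
    exact h1.trans (by rw [div_le_one (by positivity)]; linarith)
  have hαΞ : Ξ * (α / (1 - r)) ≤ 1 := by
    have h1 : α ≤ (1 - r) / (Ξ + 1) := hαle.trans ((min_le_right _ _).trans (min_le_right _ _))
    rw [← mul_div_assoc, div_le_one h1r]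
    calc Ξ * α ≤ Ξ * ((1 - r) / (Ξ + 1)) := mul_le_mul_of_nonneg_left h1 hΞ0
      _ ≤ 1 - r := by
          rw [mul_div_assoc', div_le_iff₀ (add_pos_of_nonneg_of_pos hΞ0 one_pos)]
          calc Ξ * (1 - r) ≤ Ξ * (1 - r) + (1 - r) := le_add_of_nonneg_right h1r.le
            _ = (1 - r) * (Ξ + 1) := by ring
  have hαη : 0 ≤ α * η := mul_nonneg hα0 hη0.le
  have hδη : 0 ≤ δ * η := mul_nonneg hδ0 hη0.le
  have hεR0 : 0 ≤ 2 * Mφ * Mφ' * (α * η) := mul_nonneg (mul_nonneg (mul_nonneg zero_le_two hMφ) hMφ') hαη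
  have hδR0 : 0 ≤ 2 * Mφ * Mφ' * (δ * η) := mul_nonneg (mul_nonneg (mul_nonneg zero_le_two hMφ) hMφ') hδη
  have hsSα : 0 ≤ sS * α := mul_nonneg hsS hα0
  have hsSδ : 0 ≤ sS * δ := mul_nonneg hsS hδ0
  have hsPδ : 0 ≤ sP * δ := mul_nonneg hsP hδ0
  have hsQδ : 0 ≤ sQ * δ := mul_nonneg hsQ hδ0
  have hCQα : 0 ≤ CQ * α := mul_nonneg hCQ hα0
  have hCRδ : 0 ≤ CR * δ := mul_nonneg hCR hδ0
  have hΘδ : 0 ≤ Θ * δ := mul_nonneg hΘ.le hδ0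
  have hMP2 : 0 ≤ 1 + sS * α := by positivity
  have he : Real.exp (Ξ * (α / (1 - r))) - 1 ≤ 2 * (Ξ * (α / (1 - r))) :=
    exp_sub_one_le_two_mul (mul_nonneg hΞ0 (div_nonneg hα0 h1r.le)) hαΞ
  have heM : Mφ' * Mφ * (Real.exp (Ξ * (α / (1 - r))) - 1) ≤ CQ * α := by
    have h1 := mul_le_mul_of_nonneg_left he hMM
    have h2 : Mφ' * Mφ * (2 * (Ξ * (α / (1 - r)))) = CQ * α := by rw [hCQdef]; ring
    rw [← h2]; exact h1
  have hsSe : ‖((η : ℂ))⁻¹‖ * (2 * Mφ * Mφ' * (α * η)) * Real.sqrt d = sS * α := by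
    rw [hsSdef, show ‖((η : ℂ))⁻¹‖ * (2 * Mφ * Mφ' * (α * η)) = 2 * Mφ * Mφ' * α * (‖((η : ℂ))⁻¹‖ * η) by ring, hnη]; ring
  have hsSe₂ : ‖((η : ℂ))⁻¹‖ * (2 * Mφ * Mφ' * (δ * η)) * Real.sqrt d = sS * δ := by
    rw [hsSdef, show ‖((η : ℂ))⁻¹‖ * (2 * Mφ * Mφ' * (δ * η)) = 2 * Mφ * Mφ' * δ * (‖((η : ℂ))⁻¹‖ * η) by ring, hnη]; ring
  have hMQα : Mφ' * Mφ + CQ * α ≤ MQ0 := by rw [hMQ0def]; exact add_le_add le_rfl (mul_le_of_le_one_right hCQ hαone)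
  have hCfin : (Θ * δ) / (γ₁ / 4) * (γ₁ / 4)⁻¹ +
      ((((Θ * δ) * Real.sqrt (CKV / (γ₁ / 4)) + (sQ * δ) * CKV) / (γ₁ / 4) + Real.sqrt (CKU / (γ₁ / 4)) * ((sQ * δ) * Real.sqrt (CKV / (γ₁ / 4)))) * MQ0 * (γ₁ / 4)⁻¹ +
        Real.sqrt (CKV / (γ₁ / 4)) * ((sQ * δ) * (γ₁ / 4)⁻¹ + MQ0 * ((Θ * δ) / (γ₁ / 4)) * (γ₁ / 4)⁻¹)) +
      (Real.sqrt ((γ₁ / 4)⁻¹ * 2) * ((sP * δ) * (γ₁ / 4)⁻¹ + 1 * ((Θ * δ) / (γ₁ / 4)) * (γ₁ / 4)⁻¹) +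
        ((γ₁ / 4)⁻¹ * (sS * δ) * 1 + Real.sqrt ((γ₁ / 4)⁻¹ * (γ₁ / 4)⁻¹) * (CR * δ) + (Θ * δ) / (γ₁ / 4) * Real.sqrt (2 / (γ₁ / 4))) * 1 * (γ₁ / 4)⁻¹) = Cb * δ := by
    rw [hCbdef]; ring
  have hCb1 : Cb * δ * ‖x‖ ≤ (Cb + 1) * δ * ‖x‖ :=
    mul_le_mul_of_nonneg_right (mul_le_mul_of_nonneg_right (le_add_of_nonneg_right zero_le_one) hδ0) (norm_nonneg _)
  have HU := H1 n η hηL c₀ c₁ hw hρ m U αU hα1 hU1 hreg εU hεU hUε hα0 hαα₁ hRSU hUb hUη hplU hεg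
  have HV := H1 n η hηL c₀ c₁ hw hρ m V αV hα1' hV1 hregV εU hεU hVε hα0 hαα₁ hRSV hVb hVη hplV hεg
  have HT := H2 n η hηL c₀ c₁ hw hρ m U V αU hα1 hU1 hreg αV hα1' hV1 hregV hα128 εU hεU hUε hVε δUV hδUV hLUV hα0 hαα₂ hδ0 hδδ₂ hRSU hRSV
    hUb hVb hUη hVη hplU hUV hpp hεg hδg hR2
  -- the doubled flat energy weight `N := 2N₁` (opaque)
  obtain ⟨N, hNdef⟩ : ∃ N : BondL2K ℂ d (towerP L m (n + 1)) c₀ W → ℝ, N = fun z =>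
      2 * Real.sqrt (‖covCurlL2K ℂ c₀ ((η : ℂ))⁻¹ (adTransportW φ (fun _ : Bond d (towerP L m (n + 1)) => (1 : 𝔸ˣ))) z‖ ^ 2 + ‖covDivL2K ℂ c₀ ((η : ℂ))⁻¹ (adTransportW φ fun _ : Bond d (towerP L m (n + 1)) => (1 : 𝔸ˣ)⁻¹) z‖ ^ 2 + ‖z‖ ^ 2) := ⟨_, rfl⟩
  have hNz : ∀ z, N z = 2 * Real.sqrt (‖covCurlL2K ℂ c₀ ((η : ℂ))⁻¹ (adTransportW φ (fun _ : Bond d (towerP L m (n + 1)) => (1 : 𝔸ˣ))) z‖ ^ 2 + ‖covDivL2K ℂ c₀ ((η : ℂ))⁻¹ (adTransportW φ fun _ : Bond d (towerP L m (n + 1)) => (1 : 𝔸ˣ)⁻¹) z‖ ^ 2 + ‖z‖ ^ 2) := fun z => by rw [hNdef]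
  have hN0 : ∀ z, 0 ≤ N z := fun z => by rw [hNz]; positivity
  have hNsq : ∀ z, N z ^ 2 = 4 * (‖covCurlL2K ℂ c₀ ((η : ℂ))⁻¹ (adTransportW φ (fun _ : Bond d (towerP L m (n + 1)) => (1 : 𝔸ˣ))) z‖ ^ 2 + ‖covDivL2K ℂ c₀ ((η : ℂ))⁻¹ (adTransportW φ fun _ : Bond d (towerP L m (n + 1)) => (1 : 𝔸ˣ)⁻¹) z‖ ^ 2 + ‖z‖ ^ 2) := fun z => by
    rw [hNz, mul_pow, Real.sq_sqrt (add_nonneg (add_nonneg (sq_nonneg _) (sq_nonneg _)) (sq_nonneg _))]; norm_num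
  have hN1 : ∀ z, Real.sqrt (‖covCurlL2K ℂ c₀ ((η : ℂ))⁻¹ (adTransportW φ (fun _ : Bond d (towerP L m (n + 1)) => (1 : 𝔸ˣ))) z‖ ^ 2 + ‖covDivL2K ℂ c₀ ((η : ℂ))⁻¹ (adTransportW φ fun _ : Bond d (towerP L m (n + 1)) => (1 : 𝔸ˣ)⁻¹) z‖ ^ 2 + ‖z‖ ^ 2) ≤ N z := fun z => by
    rw [hNz]; linarith [Real.sqrt_nonneg (‖covCurlL2K ℂ c₀ ((η : ℂ))⁻¹ (adTransportW φ (fun _ : Bond d (towerP L m (n + 1)) => (1 : 𝔸ˣ))) z‖ ^ 2 + ‖covDivL2K ℂ c₀ ((η : ℂ))⁻¹ (adTransportW φ fun _ : Bond d (towerP L m (n + 1)) => (1 : 𝔸ˣ)⁻¹) z‖ ^ 2 + ‖z‖ ^ 2)]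
  have hNn1 : ∀ z, ‖z‖ ≤ Real.sqrt (‖covCurlL2K ℂ c₀ ((η : ℂ))⁻¹ (adTransportW φ (fun _ : Bond d (towerP L m (n + 1)) => (1 : 𝔸ˣ))) z‖ ^ 2 + ‖covDivL2K ℂ c₀ ((η : ℂ))⁻¹ (adTransportW φ fun _ : Bond d (towerP L m (n + 1)) => (1 : 𝔸ˣ)⁻¹) z‖ ^ 2 + ‖z‖ ^ 2) := fun z =>
    le_sqrt_of_sq_le (norm_nonneg _) (le_add_of_nonneg_left (add_nonneg (sq_nonneg _) (sq_nonneg _)))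
  have hNn : ∀ z, ‖z‖ ≤ N z := fun z => (hNn1 z).trans (hN1 z)
  have hNc : ∀ z, ‖covCurlL2K ℂ c₀ ((η : ℂ))⁻¹ (adTransportW φ (fun _ : Bond d (towerP L m (n + 1)) => (1 : 𝔸ˣ))) z‖ ≤ N z := fun z =>
    (le_sqrt_of_sq_le (norm_nonneg _) ((le_add_of_nonneg_right (sq_nonneg _)).trans (le_add_of_nonneg_right (sq_nonneg _)))).trans (hN1 z)
  have hNd1 : ∀ z, ‖covDivL2K ℂ c₀ ((η : ℂ))⁻¹ (adTransportW φ fun _ : Bond d (towerP L m (n + 1)) => (1 : 𝔸ˣ)⁻¹) z‖ ≤ Real.sqrt (‖covCurlL2K ℂ c₀ ((η : ℂ))⁻¹ (adTransportW φ (fun _ : Bond d (towerP L m (n + 1)) => (1 : 𝔸ˣ))) z‖ ^ 2 + ‖covDivL2K ℂ c₀ ((η : ℂ))⁻¹ (adTransportW φ fun _ : Bond d (towerP L m (n + 1)) => (1 : 𝔸ˣ)⁻¹) z‖ ^ 2 + ‖z‖ ^ 2) := fun z =>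
    le_sqrt_of_sq_le (norm_nonneg _) ((le_add_of_nonneg_left (sq_nonneg _)).trans (le_add_of_nonneg_right (sq_nonneg _)))
  have hNd : ∀ z, ‖covDivL2K ℂ c₀ ((η : ℂ))⁻¹ (adTransportW φ fun _ : Bond d (towerP L m (n + 1)) => (1 : 𝔸ˣ)⁻¹) z‖ ≤ N z := fun z => (hNd1 z).trans (hN1 z)
  have hNid : ∀ z : BondL2K ℂ d (towerP L m (n + 1)) c₀ W, ‖(LinearMap.id : BondL2K ℂ d (towerP L m (n + 1)) c₀ W →ₗ[ℂ] BondL2K ℂ d (towerP L m (n + 1)) c₀ W) z‖ ≤ N z :=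
    fun z => by rw [LinearMap.id_apply]; exact hNn z
  have hcoerU : ∀ z, γ₁ / 4 * N z ^ 2 ≤ RCLike.re ⟪z, laplaceAk L m n φ η U hL αU hα1 hU1 hreg τ (c₀ := c₀) (c₁ := c₁) a z⟫_ℂ := fun z => by
    rw [hNsq]; have h := (HU z).1; linarith
  have hcoerV : ∀ z, γ₁ / 4 * N z ^ 2 ≤ RCLike.re ⟪z, laplaceAk L m n φ η V hL αV hα1' hV1 hregV τ (c₀ := c₀) (c₁ := c₁) a z⟫_ℂ := fun z => by
    rw [hNsq]; have h := (HV z).1; linarith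
  have hRDU : ∀ y : BondL2K ℂ d (towerP L m (n + 1)) c₀ W, ‖RofUk L m n φ η U (covDivL2K ℂ c₀ ((η : ℂ))⁻¹ (adTransportW φ fun b => (U b)⁻¹) y)‖ ^ 2 ≤
      2 * RCLike.re ⟪y, laplaceAk L m n φ η U hL αU hα1 hU1 hreg τ (c₀ := c₀) (c₁ := c₁) a y⟫_ℂ := fun y => (HU y).2.1
  have hRDV : ∀ y : BondL2K ℂ d (towerP L m (n + 1)) c₀ W, ‖RofUk L m n φ η V (covDivL2K ℂ c₀ ((η : ℂ))⁻¹ (adTransportW φ fun b => (V b)⁻¹) y)‖ ^ 2 ≤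
      2 * RCLike.re ⟪y, laplaceAk L m n φ η V hL αV hα1' hV1 hregV τ (c₀ := c₀) (c₁ := c₁) a y⟫_ℂ := fun y => (HV y).2.1
  have hT : ∀ u v : BondL2K ℂ d (towerP L m (n + 1)) c₀ W, ‖⟪u, laplaceAk L m n φ η U hL αU hα1 hU1 hreg τ (c₀ := c₀) (c₁ := c₁) a v⟫_ℂ -
      ⟪u, laplaceAk L m n φ η V hL αV hα1' hV1 hregV τ (c₀ := c₀) (c₁ := c₁) a v⟫_ℂ‖ ≤ Θ * δ * N u * N v := by
    intro u v
    have h := HT u v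
    have hu := hN1 u
    have hv := hN1 v
    have h0u := Real.sqrt_nonneg (‖covCurlL2K ℂ c₀ ((η : ℂ))⁻¹ (adTransportW φ (fun _ : Bond d (towerP L m (n + 1)) => (1 : 𝔸ˣ))) u‖ ^ 2 + ‖covDivL2K ℂ c₀ ((η : ℂ))⁻¹ (adTransportW φ fun _ : Bond d (towerP L m (n + 1)) => (1 : 𝔸ˣ)⁻¹) u‖ ^ 2 + ‖u‖ ^ 2)
    have h0v := Real.sqrt_nonneg (‖covCurlL2K ℂ c₀ ((η : ℂ))⁻¹ (adTransportW φ (fun _ : Bond d (towerP L m (n + 1)) => (1 : 𝔸ˣ))) v‖ ^ 2 + ‖covDivL2K ℂ c₀ ((η : ℂ))⁻¹ (adTransportW φ fun _ : Bond d (towerP L m (n + 1)) => (1 : 𝔸ˣ)⁻¹) v‖ ^ 2 + ‖v‖ ^ 2)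
    exact (h.trans_eq (mul_assoc _ _ _)).trans ((mul_le_mul_of_nonneg_left (mul_le_mul hu hv h0v (hN0 u)) hΘδ).trans_eq (mul_assoc _ _ _).symm)
  have hRεV : ∀ (b : Bond d (towerP L m (n + 1))) (w : W), ‖adTransportW φ V b w - w‖ ≤ (2 * Mφ * Mφ' * (α * η)) * ‖w‖ := fun b w => norm_adTransportW_sub_le φ hφ hφ' hMφ' V b (hVb b) (hVη b) w
  have hRUV : ∀ (b : Bond d (towerP L m (n + 1))) (w : W), ‖adTransportW φ U b w - adTransportW φ V b w‖ ≤ (2 * Mφ * Mφ' * (δ * η)) * ‖w‖ :=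
    fun b w => norm_adTransportW_sub_adTransportW_le (L := L) (m := towerP L m n) φ hφ hφ' hMφ' U V b (hUb b) (hVb b) (hUV b) w
  have hR₁ : ∀ (b : Bond d (towerP L m (n + 1))) (w : W), adTransportW φ (fun _ : Bond d (towerP L m (n + 1)) => (1 : 𝔸ˣ)) b w = w := fun b w => by rw [adTransportW_one]; rfl
  have hS₁ : ∀ (b : Bond d (towerP L m (n + 1))) (w : W), adTransportW φ (fun _ : Bond d (towerP L m (n + 1)) => (1 : 𝔸ˣ)⁻¹) b w = w := fun b w => by rw [adTransportW_inv_one]; rfl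
  have hDd : ∀ s : SiteL2K ℂ d (towerP L m (n + 1)) c₀ W, ‖covDerivL2K ℂ c₀ ((η : ℂ))⁻¹ (adTransportW φ U) s - covDerivL2K ℂ c₀ ((η : ℂ))⁻¹ (adTransportW φ V) s‖ ≤ (sS * δ) * ‖s‖ := fun s => by
    have h := norm_covDerivL2K_sub_le₂ ((η : ℂ))⁻¹ hδR0 hRUV s
    rw [hsSe₂] at h; exact h
  have hSUV : ∀ w : BondL2K ℂ d (towerP L m (n + 1)) c₀ W, ‖covDivL2K ℂ c₀ ((η : ℂ))⁻¹ (adTransportW φ fun b => (U b)⁻¹) w - covDivL2K ℂ c₀ ((η : ℂ))⁻¹ (adTransportW φ fun b => (V b)⁻¹) w‖ ≤ (sS * δ) * ‖w‖ := fun w => by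
    have h := norm_covDivL2K_sub_le₂ ((η : ℂ))⁻¹ hc hδR0 hRUV hRSU hRSV w
    rw [hsSe₂] at h; exact h
  have hSV : ∀ w : BondL2K ℂ d (towerP L m (n + 1)) c₀ W, ‖covDivL2K ℂ c₀ ((η : ℂ))⁻¹ (adTransportW φ fun b => (V b)⁻¹) w‖ ≤ N w := fun w => by
    have h := norm_covDivL2K_sub_le ((η : ℂ))⁻¹ hc hεR0 hRεV hR₁ hRSV hS₁ w
    rw [hsSe] at h
    have h2 := norm_le_norm_add_norm_sub' (covDivL2K ℂ c₀ ((η : ℂ))⁻¹ (adTransportW φ fun b => (V b)⁻¹) w) (covDivL2K ℂ c₀ ((η : ℂ))⁻¹ (adTransportW φ fun _ : Bond d (towerP L m (n + 1)) => (1 : 𝔸ˣ)⁻¹) w)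
    have h3 : sS * α * ‖w‖ ≤ 1 * Real.sqrt (‖covCurlL2K ℂ c₀ ((η : ℂ))⁻¹ (adTransportW φ (fun _ : Bond d (towerP L m (n + 1)) => (1 : 𝔸ˣ))) w‖ ^ 2 + ‖covDivL2K ℂ c₀ ((η : ℂ))⁻¹ (adTransportW φ fun _ : Bond d (towerP L m (n + 1)) => (1 : 𝔸ˣ)⁻¹) w‖ ^ 2 + ‖w‖ ^ 2) :=
      mul_le_mul hsSα1 (hNn1 w) (norm_nonneg _) zero_le_one
    calc _ ≤ Real.sqrt (‖covCurlL2K ℂ c₀ ((η : ℂ))⁻¹ (adTransportW φ (fun _ : Bond d (towerP L m (n + 1)) => (1 : 𝔸ˣ))) w‖ ^ 2 + ‖covDivL2K ℂ c₀ ((η : ℂ))⁻¹ (adTransportW φ fun _ : Bond d (towerP L m (n + 1)) => (1 : 𝔸ˣ)⁻¹) w‖ ^ 2 + ‖w‖ ^ 2) + sS * α * ‖w‖ := h2.trans (add_le_add (hNd1 w) h)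
      _ ≤ N w := by rw [hNz]; linarith
  have hRle : ∀ v : SiteL2K ℂ d (towerP L m (n + 1)) c₀ W, ‖RofUk L m n φ η U v‖ ≤ ‖v‖ := fun v => by unfold RofUk B11Eq103H1Complex.RLatticeK; exact norm_projR_le _ _ v
  have hRVle : ∀ v : SiteL2K ℂ d (towerP L m (n + 1)) c₀ W, ‖RofUk L m n φ η V v‖ ≤ ‖v‖ := fun v => by unfold RofUk B11Eq103H1Complex.RLatticeK; exact norm_projR_le _ _ v
  have hRone : ∀ v : SiteL2K ℂ d (towerP L m (n + 1)) c₀ W, ‖RofUk L m n φ η U v‖ ≤ 1 * ‖v‖ := fun v => by rw [one_mul]; exact hRle v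
  have hP : ∀ w : BondL2K ℂ d (towerP L m (n + 1)) c₀ W, ‖RofUk L m n φ η U (covDivL2K ℂ c₀ ((η : ℂ))⁻¹ (adTransportW φ fun b => (U b)⁻¹) w) -
      RofUk L m n φ η V (covDivL2K ℂ c₀ ((η : ℂ))⁻¹ (adTransportW φ fun b => (V b)⁻¹) w)‖ ≤ (sP * δ) * N w := by
    intro w
    have h1 : ‖RofUk L m n φ η U (covDivL2K ℂ c₀ ((η : ℂ))⁻¹ (adTransportW φ fun b => (U b)⁻¹) w) - RofUk L m n φ η U (covDivL2K ℂ c₀ ((η : ℂ))⁻¹ (adTransportW φ fun b => (V b)⁻¹) w)‖ ≤ (sS * δ) * ‖w‖ := by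
      rw [← map_sub]; exact (hRle _).trans (hSUV w)
    have h2 := hR2 (covDivL2K ℂ c₀ ((η : ℂ))⁻¹ (adTransportW φ fun b => (V b)⁻¹) w)
    have h3 := norm_sub_le_norm_sub_add_norm_sub (RofUk L m n φ η U (covDivL2K ℂ c₀ ((η : ℂ))⁻¹ (adTransportW φ fun b => (U b)⁻¹) w)) (RofUk L m n φ η U (covDivL2K ℂ c₀ ((η : ℂ))⁻¹ (adTransportW φ fun b => (V b)⁻¹) w))
      (RofUk L m n φ η V (covDivL2K ℂ c₀ ((η : ℂ))⁻¹ (adTransportW φ fun b => (V b)⁻¹) w))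
    have h4 : (sS * δ) * ‖w‖ ≤ (sS * δ) * N w := mul_le_mul_of_nonneg_left (hNn w) hsSδ
    have h5 : CR * δ * ‖covDivL2K ℂ c₀ ((η : ℂ))⁻¹ (adTransportW φ fun b => (V b)⁻¹) w‖ ≤ CR * δ * N w := mul_le_mul_of_nonneg_left (hSV w) hCRδ
    have h6 : (sS * δ) * N w + CR * δ * N w ≤ (sP * δ) * N w := by
      have h7 : 0 ≤ CR * δ * N w := mul_nonneg hCRδ (hN0 w)
      have e : (sS + 2 * CR) * δ * N w = (sS * δ) * N w + CR * δ * N w + CR * δ * N w := by ring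
      rw [hsPdef, e]; linarith
    exact h3.trans ((add_le_add (h1.trans h4) (h2.trans h5)).trans h6)
  have hP₀ : ∀ w : BondL2K ℂ d (towerP L m (n + 1)) c₀ W, ‖RofUk L m n φ η V (covDivL2K ℂ c₀ ((η : ℂ))⁻¹ (adTransportW φ fun b => (V b)⁻¹) w)‖ ≤ 1 * N w :=
    fun w => (hRVle _).trans (by rw [one_mul]; exact hSV w)
  have hδmax : ∀ j, δUV j ≤ 1 / (12288 * ((2 * (d * L) + L + L : ℕ) : ℝ)) := fun j =>
    (hδg j).trans ((mul_le_of_le_one_right hδ0 (pow_le_one₀ hr0 hr1.le)).trans hδN)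
  have hwin : Real.sqrt ((L : ℝ) ^ d) * (Real.sqrt (2 * d) * (75497472 * ((d : ℝ) + 1) * ((2 * (d * L) + L + L : ℕ) : ℝ))) / (1 - r) * δ ≤ 1 := by
    rw [← hBQdef]; exact hδB
  have hQd : ∀ w : BondL2K ℂ d (towerP L m (n + 1)) c₀ W, ‖(QkW L m n φ U hL αU hα1 hU1 hreg (c₀ := c₀) (c₁ := c₁)) w -
      (QkW L m n φ V hL αV hα1' hV1 hregV (c₀ := c₀) (c₁ := c₁)) w‖ ≤ (sQ * δ) * ‖w‖ := fun w => by
    have h := norm_QkW_sub_QkW_le_L2_linear L m n hL φ hMφ hMφ' hφ hφ' (c₀ := c₀) (c₁ := c₁) U V αU hα1 hU1 hreg αV hα1' hV1 hregV hα128 εU hεU hUε hVε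
      δUV hδUV hδmax hLUV hr0 hr1 hα0 hδ0 hεg (fun j _ => hδg j) hwin w
    rw [sqrt_ratio_diagonal hc₁ hw, mul_one, ← hBQdef] at h
    have hexp : Real.exp (Real.sqrt ((L : ℝ) ^ d) * (Real.sqrt (2 * d) * (102 * (d + 1) ^ 2 * L)) * (α / (1 - r))) ≤ Real.exp 1 := by
      rw [← hΞdef]; exact Real.exp_le_exp.2 hαΞ
    have h2 : Mφ' * Mφ * (2 * Real.exp (Real.sqrt ((L : ℝ) ^ d) * (Real.sqrt (2 * d) * (102 * (d + 1) ^ 2 * L)) * (α / (1 - r))) * (BQ * δ)) ≤ sQ * δ := by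
      rw [hsQdef]
      have := mul_le_mul_of_nonneg_right hexp (mul_nonneg hBQ hδ0)
      calc Mφ' * Mφ * (2 * Real.exp (Real.sqrt ((L : ℝ) ^ d) * (Real.sqrt (2 * d) * (102 * (d + 1) ^ 2 * L)) * (α / (1 - r))) * (BQ * δ))
          = (Mφ' * Mφ * 2) * (Real.exp (Real.sqrt ((L : ℝ) ^ d) * (Real.sqrt (2 * d) * (102 * (d + 1) ^ 2 * L)) * (α / (1 - r))) * (BQ * δ)) := by ring
        _ ≤ (Mφ' * Mφ * 2) * (Real.exp 1 * (BQ * δ)) := mul_le_mul_of_nonneg_left this (by positivity)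
        _ = Mφ' * Mφ * (2 * Real.exp 1 * BQ) * δ := by ring
    exact h.trans (mul_le_mul_of_nonneg_right h2 (norm_nonneg _))
  have hQ1b : ∀ w : BondL2K ℂ d (towerP L m (n + 1)) c₀ W, ‖(QkW L m n φ (fun _ : Bond d (towerP L m (n + 1)) => (1 : 𝔸ˣ)) hL (fun _ => 0) (fun _ => by norm_num)
      (perCfg_UlevOf_one_mem_U1 L m (n + 1)) (norm_Wcx_UlevOf_one_sub_one_le L m (n + 1) (fun _ => 0) (fun _ => le_rfl)) (c₀ := c₀) (c₁ := c₁)) w‖ ≤ Mφ' * Mφ * ‖w‖ := fun w => by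
    have h := norm_QkW_one_le_canonical L m n hL φ hMφ hφ hMφ' hφ' (fun _ => 0) (fun _ => by norm_num)
      (perCfg_UlevOf_one_mem_U1 L m (n + 1)) (norm_Wcx_UlevOf_one_sub_one_le L m (n + 1) (fun _ => 0) (fun _ => le_rfl)) (c₀ := c₀) (c₁ := c₁) hηL0 hs w
    rw [hηL, inv_one, mul_one] at h
    exact h
  have hQXb : ∀ (X : Bond d (towerP L m (n + 1)) → 𝔸ˣ) (αX : ℕ → ℝ) (hα1X : ∀ j, αX j ≤ 1 / 64)
      (hX1 : ∀ (j : ℕ) (x : B7Prop1Explicit.Site d) (κ : Fin d), perCfg (towerP L m (j + 1)) (UlevOf L m (n + 1) X j) x κ ∈ U1 𝔸)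
      (hregX : ∀ (j : ℕ) (y : TSite d (towerP L m j)) (κ : Fin d) (r : Fin d → Fin L),
        ‖((Wcx L (perCfg (towerP L m (j + 1)) (UlevOf L m (n + 1) X j)) (cornerSite L y) κ (boxVec L r) : 𝔸ˣ) : 𝔸) - 1‖ ≤ αX j),
      (∀ (j : ℕ) (b : Bond d (towerP L m (j + 1))), ‖(UlevOf L m (n + 1) X j b : 𝔸) - 1‖ ≤ εU j) →
      ∀ w : BondL2K ℂ d (towerP L m (n + 1)) c₀ W, ‖(QkW L m n φ X hL αX hα1X hX1 hregX (c₀ := c₀) (c₁ := c₁)) w‖ ≤ MQ0 * ‖w‖ := by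
    intro X αX hα1X hX1 hregX hXε w
    have h := norm_QkW_sub_flat_le_L2_geometric L m n hL φ hMφ hMφ' hφ hφ' (c₀ := c₀) (c₁ := c₁) X αX hα1X hX1 hregX εU hεU hXε hr0 hr1 hα0 hεg w
    rw [sqrt_ratio_diagonal hc₁ hw, mul_one, ← hΞdef] at h
    have hd := h.trans (mul_le_mul_of_nonneg_right heM (norm_nonneg _))
    have h2 := norm_le_norm_add_norm_sub' ((QkW L m n φ X hL αX hα1X hX1 hregX (c₀ := c₀) (c₁ := c₁)) w) ((QkW L m n φ (fun _ : Bond d (towerP L m (n + 1)) => (1 : 𝔸ˣ)) hL (fun _ => 0) (fun _ => by norm_num)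
      (perCfg_UlevOf_one_mem_U1 L m (n + 1)) (norm_Wcx_UlevOf_one_sub_one_le L m (n + 1) (fun _ => 0) (fun _ => le_rfl)) (c₀ := c₀) (c₁ := c₁)) w)
    calc _ ≤ Mφ' * Mφ * ‖w‖ + CQ * α * ‖w‖ := h2.trans (add_le_add (hQ1b w) hd)
      _ = (Mφ' * Mφ + CQ * α) * ‖w‖ := by ring
      _ ≤ MQ0 * ‖w‖ := mul_le_mul_of_nonneg_right hMQα (norm_nonneg _)
  have hQUb := hQXb U αU hα1 hU1 hreg hUε
  have hQVb := hQXb V αV hα1' hV1 hregV hVε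
  have hadjU : ∀ (y : BondL2K ℂ d (towerP L m (n + 1)) c₀ W) (z : BondL2K ℂ d m c₁ W), ⟪(QkW L m n φ U hL αU hα1 hU1 hreg (c₀ := c₀) (c₁ := c₁)) y, z⟫_ℂ =
      ⟪y, LinearMap.adjoint (QkW L m n φ U hL αU hα1 hU1 hreg (c₀ := c₀) (c₁ := c₁)) z⟫_ℂ := fun y z => (LinearMap.adjoint_inner_right _ y z).symm
  have hadjV : ∀ (y : BondL2K ℂ d (towerP L m (n + 1)) c₀ W) (z : BondL2K ℂ d m c₁ W), ⟪(QkW L m n φ V hL αV hα1' hV1 hregV (c₀ := c₀) (c₁ := c₁)) y, z⟫_ℂ =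
      ⟪y, LinearMap.adjoint (QkW L m n φ V hL αV hα1' hV1 hregV (c₀ := c₀) (c₁ := c₁)) z⟫_ℂ := fun y z => (LinearMap.adjoint_inner_right _ y z).symm
  have hinjU := adjoint_injective_of_surjective _ hQU
  have hinjV := adjoint_injective_of_surjective _ hQV
  have hDDU : ∀ (s : SiteL2K ℂ d (towerP L m (n + 1)) c₀ W) (y : BondL2K ℂ d (towerP L m (n + 1)) c₀ W), ⟪covDerivL2K ℂ c₀ ((η : ℂ))⁻¹ (adTransportW φ U) s, y⟫_ℂ =
      ⟪s, covDivL2K ℂ c₀ ((η : ℂ))⁻¹ (adTransportW φ fun b => (U b)⁻¹) y⟫_ℂ := by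
    intro s y; rw [← adjoint_covDerivL2K ((η : ℂ))⁻¹ hc _ _ hRSU, LinearMap.adjoint_inner_right]
  have hDDV : ∀ (s : SiteL2K ℂ d (towerP L m (n + 1)) c₀ W) (y : BondL2K ℂ d (towerP L m (n + 1)) c₀ W), ⟪covDerivL2K ℂ c₀ ((η : ℂ))⁻¹ (adTransportW φ V) s, y⟫_ℂ =
      ⟪s, covDivL2K ℂ c₀ ((η : ℂ))⁻¹ (adTransportW φ fun b => (V b)⁻¹) y⟫_ℂ := by
    intro s y; rw [← adjoint_covDerivL2K ((η : ℂ))⁻¹ hc _ _ hRSV, LinearMap.adjoint_inner_right]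
  have hRsymU : ∀ s t : SiteL2K ℂ d (towerP L m (n + 1)) c₀ W, ⟪RofUk L m n φ η U s, t⟫_ℂ = ⟪s, RofUk L m n φ η U t⟫_ℂ := fun s t => RofUk_isSymmetric L m n φ η U s t
  have hRsymV : ∀ s t : SiteL2K ℂ d (towerP L m (n + 1)) c₀ W, ⟪RofUk L m n φ η V s, t⟫_ℂ = ⟪s, RofUk L m n φ η V t⟫_ℂ := fun s t => RofUk_isSymmetric L m n φ η V s t
  have hRRU : ∀ s : SiteL2K ℂ d (towerP L m (n + 1)) c₀ W, RofUk L m n φ η U (RofUk L m n φ η U s) = RofUk L m n φ η U s := fun s => by unfold RofUk B11Eq103H1Complex.RLatticeK; exact projR_projR _ _ s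
  have hRRV : ∀ s : SiteL2K ℂ d (towerP L m (n + 1)) c₀ W, RofUk L m n φ η V (RofUk L m n φ η V s) = RofUk L m n φ η V s := fun s => by unfold RofUk B11Eq103H1Complex.RLatticeK; exact projR_projR _ _ s
  -- `norm_apply_frakG_sub_le` (structure 1 := `U`, structure 0 := `V`)
  refine ⟨?_, ?_, ?_⟩
  · refine le_trans ?_ hCb1
    rw [← hCfin]
    have h := norm_apply_frakG_sub_le (𝕜 := ℂ) hposV hadjV hinjV hposU hadjU hinjU N hN0 hNn hγ4 hγ4 hΘδ hsQδ hCKV hCKU hMQ0 hsPδ zero_le_one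
      (by norm_num : (0 : ℝ) ≤ 2) (by norm_num : (0 : ℝ) ≤ 2) hsSδ hCRδ zero_le_one hcoerU hcoerV hT hQd hKV hKU hQUb hQVb hP hP₀ hRDU hRDV hDDV hDDU
      hRsymV hRsymU hRRV hRRU hSV hDd hR2 hRone (LinearMap.id : BondL2K ℂ d (towerP L m (n + 1)) c₀ W →ₗ[ℂ] BondL2K ℂ d (towerP L m (n + 1)) c₀ W) hNid x
    rw [LinearMap.id_apply] at h
    exact h
  · refine le_trans ?_ hCb1
    rw [← hCfin]
    exact norm_apply_frakG_sub_le (𝕜 := ℂ) hposV hadjV hinjV hposU hadjU hinjU N hN0 hNn hγ4 hγ4 hΘδ hsQδ hCKV hCKU hMQ0 hsPδ zero_le_one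
      (by norm_num : (0 : ℝ) ≤ 2) (by norm_num : (0 : ℝ) ≤ 2) hsSδ hCRδ zero_le_one hcoerU hcoerV hT hQd hKV hKU hQUb hQVb hP hP₀ hRDU hRDV hDDV hDDU
      hRsymV hRsymU hRRV hRRU hSV hDd hR2 hRone (covCurlL2K ℂ c₀ ((η : ℂ))⁻¹ (adTransportW φ (fun _ : Bond d (towerP L m (n + 1)) => (1 : 𝔸ˣ)))) hNc x
  · refine le_trans ?_ hCb1
    rw [← hCfin]
    exact norm_apply_frakG_sub_le (𝕜 := ℂ) hposV hadjV hinjV hposU hadjU hinjU N hN0 hNn hγ4 hγ4 hΘδ hsQδ hCKV hCKU hMQ0 hsPδ zero_le_one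
      (by norm_num : (0 : ℝ) ≤ 2) (by norm_num : (0 : ℝ) ≤ 2) hsSδ hCRδ zero_le_one hcoerU hcoerV hT hQd hKV hKU hQUb hQVb hP hP₀ hRDU hRDV hDDV hDDU
      hRsymV hRsymU hRRV hRRU hSV hDd hR2 hRone (covDivL2K ℂ c₀ ((η : ℂ))⁻¹ (adTransportW φ fun _ : Bond d (towerP L m (n + 1)) => (1 : 𝔸ˣ)⁻¹)) hNd x

end Literature.MathematicalPhysics.QuantumFieldTheory.Balaban1983to89.B9Eq3153FrakGkLipschitzEnergyTwoBackgrounds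

end
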